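import Literature.Topology.FourManifolds.FishtailFace
import Literature.Topology.FourManifolds.FishtailBendV2
import Literature.Topology.FourManifolds.FishtailHoleLift
import Literature.Topology.FourManifolds.FishtailTubeALocal
import HarnessLib

/-!
# The shell of Gompf's box and the corner at the hole are local diffeomorphisms

Infrastructure for the explicit fishtail neighbourhood (R. Gompf, *More Cappell–Shaneson spheres
are standard*, Algebr. Geom. Topol. 10 (2010), proof of Thm 2.1 (the box `N = I₀ × [0,1] × T²`)
and Lemma 2.2 (`Φ = N ∪_γ` 2-handle); the named fact
`Literature.Topology.FourManifolds.gompf2010_framedTwist`). Two pieces of the embedding of the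
fishtail end model, in real coordinates:

* **the box shell** `(n, ℓ, θ, e) ↦ (n, ℓ - C, t, y)`, `(t, y) = (faceT θ e, faceY θ e)`
  (`FishtailFace.lean`: polar-type coordinates of the `(t, y)`-square about its centre, depth `e`
  inward), with an arbitrary smooth gauge `C(n, θ, e)`:
  `Literature.Topology.FourManifolds.faceJac` (the planar Jacobian of the shell is
  `(1 - e) R(θ)²`), `Literature.Topology.FourManifolds.isLocalDiffeomorphAt_faceGraph`,
  `Literature.Topology.FourManifolds.boxShellMap` and
  `Literature.Topology.FourManifolds.isLocalDiffeomorphAt_boxShellMap` (a shear in `ℓ` followed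
  by the graph of the shell);
* **the corner at the hole** `(ϱ, φ, ℓ, e) ↦ (W e^{iφ}, 1 + E h, ℓ + φ - Ŝ(ϱ, φ))`,
  `(W, E) = fishBend (ϱ, e)` (`FishtailBendV2.lean`), `Ŝ` any smooth function (the cut-off lift
  `holeS`, `FishtailHoleLift.lean`): `Literature.Topology.FourManifolds.fishBendDiffeo` (Gompf's
  bend as a diffeomorphism of the plane), `Literature.Topology.FourManifolds.cornerMap` and
  `Literature.Topology.FourManifolds.isLocalDiffeomorphAt_cornerMap` (for `W > 0`).

Everything is proved; no named facts.

## References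

* R. E. Gompf, *More Cappell–Shaneson spheres are standard*, Algebr. Geom. Topol. 10 (2010)
  1665–1681, proof of Thm 2.1 and Lemma 2.2. [GompfAGT2010]
-/

noncomputable section

open scoped Real ContDiff Topology Manifold
open Set Function Filter Complex

namespace Literature.Topology.FourManifolds

/-! ### The shell of the box -/

section Face

/-- The unit direction `u(θ) = (-sin θ, cos θ)` of the shell and its derivative. [folklore] -/
theorem hasDerivAt_bxR (θ : ℝ) : HasDerivAt bxR (deriv bxR θ) θ :=
  ((contDiff_boxR (h := bxH) (R₀ := bxH) bxPhi1_nonneg bxPhi1_lt_bxPhi2 bxPhi2_lt).differentiable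
    (by simp) θ).hasDerivAt

/-- The partial derivative of the shell in the depth: `∂_e (t, y) = (R sin θ, -R cos θ)`. [folklore] -/
theorem hasDerivAt_face_e (θ e : ℝ) :
    HasDerivAt (fun e' ↦ (faceT θ e', faceY θ e')) (bxR θ * Real.sin θ, -(bxR θ * Real.cos θ)) e := by
  refine HasDerivAt.prodMk ?_ ?_
  · have h : HasDerivAt (fun e' ↦ 1 + bxH - (1 - e') * (bxR θ * Real.sin θ))
        (0 - (0 - 1) * (bxR θ * Real.sin θ)) e :=
      (hasDerivAt_const e _).sub (((hasDerivAt_const e _).sub (hasDerivAt_id e)).mul_const _)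
    have heq : faceT θ = fun e' ↦ 1 + bxH - (1 - e') * (bxR θ * Real.sin θ) := by
      funext e'; simp only [faceT]; ring
    rw [heq]
    exact h.congr_deriv (by ring)
  · have h : HasDerivAt (fun e' ↦ cY + (1 - e') * (bxR θ * Real.cos θ))
        (0 + (0 - 1) * (bxR θ * Real.cos θ)) e :=
      (hasDerivAt_const e _).add (((hasDerivAt_const e _).sub (hasDerivAt_id e)).mul_const _)
    have heq : faceY θ = fun e' ↦ cY + (1 - e') * (bxR θ * Real.cos θ) := by
      funext e'; simp only [faceY]; ring
    rw [heq]
    exact h.congr_deriv (by ring)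

/-- The partial derivative of the shell in the angle. [folklore] -/
theorem hasDerivAt_face_theta (θ e : ℝ) :
    HasDerivAt (fun θ' ↦ (faceT θ' e, faceY θ' e))
      (-((1 - e) * (deriv bxR θ * Real.sin θ + bxR θ * Real.cos θ)),
        (1 - e) * (deriv bxR θ * Real.cos θ - bxR θ * Real.sin θ)) θ := by
  have hR := hasDerivAt_bxR θ
  have hs := Real.hasDerivAt_sin θ
  have hc := Real.hasDerivAt_cos θ
  refine HasDerivAt.prodMk ?_ ?_
  · have h : HasDerivAt (fun θ' ↦ 1 + bxH - (1 - e) * (bxR θ' * Real.sin θ'))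
        (0 - (1 - e) * (deriv bxR θ * Real.sin θ + bxR θ * Real.cos θ)) θ :=
      (hasDerivAt_const θ _).sub ((hR.mul hs).const_mul (1 - e))
    have heq : (fun θ' ↦ faceT θ' e) = fun θ' ↦ 1 + bxH - (1 - e) * (bxR θ' * Real.sin θ') := by
      funext θ'; simp only [faceT]; ring
    rw [heq]
    exact h.congr_deriv (by ring)
  · have h : HasDerivAt (fun θ' ↦ cY + (1 - e) * (bxR θ' * Real.cos θ'))
        (0 + (1 - e) * (deriv bxR θ * Real.cos θ + bxR θ * -Real.sin θ)) θ :=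
      (hasDerivAt_const θ _).add ((hR.mul hc).const_mul (1 - e))
    have heq : (fun θ' ↦ faceY θ' e) = fun θ' ↦ cY + (1 - e) * (bxR θ' * Real.cos θ') := by
      funext θ'; simp only [faceY]; ring
    rw [heq]
    exact h.congr_deriv (by ring)

/-- **The planar Jacobian of the shell is `(1 - e) R(θ)²`.** [folklore] -/
theorem faceJac (θ e : ℝ) :
    let u : ℝ × ℝ := (-((1 - e) * (deriv bxR θ * Real.sin θ + bxR θ * Real.cos θ)),
      (1 - e) * (deriv bxR θ * Real.cos θ - bxR θ * Real.sin θ))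
    let v : ℝ × ℝ := (bxR θ * Real.sin θ, -(bxR θ * Real.cos θ))
    u.1 * v.2 - u.2 * v.1 = (1 - e) * bxR θ ^ 2 := by
  intro u v
  simp only [u, v]
  linear_combination (1 - e) * bxR θ ^ 2 * Real.sin_sq_add_cos_sq θ

/-- The planar Jacobian does not vanish for `e < 1`. [folklore] -/
theorem faceJac_ne_zero {e : ℝ} (he : e < 1) (θ : ℝ) : (1 - e) * bxR θ ^ 2 ≠ 0 :=
  mul_ne_zero (by linarith) (pow_ne_zero 2 (bxR_pos θ).ne')

variable {P : Type*} [NormedAddCommGroup P] [NormedSpace ℝ P] [CompleteSpace P]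

/-- **The graph of the shell over any carried coordinates is a local diffeomorphism** for `e < 1`. [folklore] -/
theorem isLocalDiffeomorphAt_faceGraph {q : P × (ℝ × ℝ)} (he : q.2.2 < 1) :
    IsLocalDiffeomorphAt 𝓘(ℝ, P × (ℝ × ℝ)) 𝓘(ℝ, P × (ℝ × ℝ)) ∞
      (fun q : P × (ℝ × ℝ) ↦ (q.1, (faceT q.2.1 q.2.2, faceY q.2.1 q.2.2))) q := by
  have hf : ContDiff ℝ ∞ fun q : P × (ℝ × ℝ) ↦ (faceT q.2.1 q.2.2, faceY q.2.1 q.2.2) :=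
    contDiff_faceTY.comp contDiff_snd
  have hD := faceJac q.2.1 q.2.2
  simp only at hD
  have hD' : (-((1 - q.2.2) * (deriv bxR q.2.1 * Real.sin q.2.1 + bxR q.2.1 * Real.cos q.2.1))) *
      (-(bxR q.2.1 * Real.cos q.2.1)) -
      ((1 - q.2.2) * (deriv bxR q.2.1 * Real.cos q.2.1 - bxR q.2.1 * Real.sin q.2.1)) * (bxR q.2.1 * Real.sin q.2.1) ≠ 0 := by
    rw [hD]; exact faceJac_ne_zero he q.2.1
  refine isLocalDiffeomorphAt_graph' hf (by exact_mod_cast le_top)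
    (pair2EquivProd (-((1 - q.2.2) * (deriv bxR q.2.1 * Real.sin q.2.1 + bxR q.2.1 * Real.cos q.2.1)),
        (1 - q.2.2) * (deriv bxR q.2.1 * Real.cos q.2.1 - bxR q.2.1 * Real.sin q.2.1))
      (bxR q.2.1 * Real.sin q.2.1, -(bxR q.2.1 * Real.cos q.2.1)) hD') ?_
  have hd : DifferentiableAt ℝ (fun x : ℝ × ℝ ↦ (faceT x.1 x.2, faceY x.1 x.2)) q.2 :=
    (contDiff_faceTY.differentiable (by simp)).differentiableAt
  have h := hasFDerivAt_of_partials hd (hasDerivAt_face_theta q.2.1 q.2.2) (hasDerivAt_face_e q.2.1 q.2.2)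
  rw [coe_pair2EquivProd]
  exact h

variable (C : ℝ → ℝ → ℝ → ℝ)

/-- **The box shell map** `(n, ℓ, θ, e) ↦ (n, ℓ - C(n, θ, e), faceT θ e, faceY θ e)` with a smooth
gauge `C`. [cite: GompfAGT2010, Thm 2.1 (proof: N = I₀ × [0,1] × T², shrunk inside itself)] -/
def boxShellMap (q : ℝ × ℝ × ℝ × ℝ) : ℝ × ℝ × ℝ × ℝ :=
  (q.1, q.2.1 - C q.1 q.2.2.1 q.2.2.2, faceT q.2.2.1 q.2.2.2, faceY q.2.2.1 q.2.2.2)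

/-- The gauge shear `(n, ℓ, θ, e) ↦ (n, ℓ - C(n, θ, e), θ, e)`. [folklore] -/
def boxGaugeShear (q : ℝ × ℝ × ℝ × ℝ) : ℝ × ℝ × ℝ × ℝ :=
  (q.1, q.2.1 - C q.1 q.2.2.1 q.2.2.2, q.2.2.1, q.2.2.2)

/-- The reordering `(n, ℓ, θ, e) ↦ ((n, θ, e), ℓ)`, a diffeomorphism. [folklore] -/
def boxIn : (ℝ × ℝ × ℝ × ℝ) ≃ₘ⟮𝓘(ℝ, ℝ × ℝ × ℝ × ℝ), 𝓘(ℝ, (ℝ × ℝ × ℝ) × ℝ)⟯ ((ℝ × ℝ × ℝ) × ℝ) where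
  toFun q := ((q.1, q.2.2.1, q.2.2.2), q.2.1)
  invFun p := (p.1.1, p.2, p.1.2.1, p.1.2.2)
  left_inv q := by simp
  right_inv p := by simp
  contMDiff_toFun := by
    refine contMDiff_iff_contDiff.2 ?_
    have h1 : ContDiff ℝ ∞ fun q : ℝ × ℝ × ℝ × ℝ ↦ q.1 := contDiff_fst
    have h2 : ContDiff ℝ ∞ fun q : ℝ × ℝ × ℝ × ℝ ↦ q.2.1 := contDiff_fst.comp contDiff_snd
    have h3 : ContDiff ℝ ∞ fun q : ℝ × ℝ × ℝ × ℝ ↦ q.2.2.1 := contDiff_fst.comp (contDiff_snd.comp contDiff_snd)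
    have h4 : ContDiff ℝ ∞ fun q : ℝ × ℝ × ℝ × ℝ ↦ q.2.2.2 := contDiff_snd.comp (contDiff_snd.comp contDiff_snd)
    exact (h1.prodMk (h3.prodMk h4)).prodMk h2
  contMDiff_invFun := by
    refine contMDiff_iff_contDiff.2 ?_
    have h1 : ContDiff ℝ ∞ fun p : (ℝ × ℝ × ℝ) × ℝ ↦ p.1.1 := contDiff_fst.comp contDiff_fst
    have h2 : ContDiff ℝ ∞ fun p : (ℝ × ℝ × ℝ) × ℝ ↦ p.1.2.1 := contDiff_fst.comp (contDiff_snd.comp contDiff_fst)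
    have h3 : ContDiff ℝ ∞ fun p : (ℝ × ℝ × ℝ) × ℝ ↦ p.1.2.2 := contDiff_snd.comp (contDiff_snd.comp contDiff_fst)
    have h4 : ContDiff ℝ ∞ fun p : (ℝ × ℝ × ℝ) × ℝ ↦ p.2 := contDiff_snd
    exact h1.prodMk (h4.prodMk (h2.prodMk h3))

/-- The value of `boxIn`. [folklore] -/
@[simp] theorem boxIn_apply (q : ℝ × ℝ × ℝ × ℝ) : boxIn q = ((q.1, q.2.2.1, q.2.2.2), q.2.1) := rfl

/-- The value of `boxIn.symm`. [folklore] -/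
@[simp] theorem boxIn_symm_apply (p : (ℝ × ℝ × ℝ) × ℝ) : boxIn.symm p = (p.1.1, p.2, p.1.2.1, p.1.2.2) := rfl

/-- The reordering `(n, ℓ, θ, e) ↦ ((n, ℓ), (θ, e))`, a diffeomorphism. [folklore] -/
def boxIn2 : (ℝ × ℝ × ℝ × ℝ) ≃ₘ⟮𝓘(ℝ, ℝ × ℝ × ℝ × ℝ), 𝓘(ℝ, (ℝ × ℝ) × (ℝ × ℝ))⟯ ((ℝ × ℝ) × (ℝ × ℝ)) where
  toFun q := ((q.1, q.2.1), (q.2.2.1, q.2.2.2))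
  invFun p := (p.1.1, p.1.2, p.2.1, p.2.2)
  left_inv q := by simp
  right_inv p := by simp
  contMDiff_toFun := by
    refine contMDiff_iff_contDiff.2 ?_
    have h1 : ContDiff ℝ ∞ fun q : ℝ × ℝ × ℝ × ℝ ↦ q.1 := contDiff_fst
    have h2 : ContDiff ℝ ∞ fun q : ℝ × ℝ × ℝ × ℝ ↦ q.2.1 := contDiff_fst.comp contDiff_snd
    have h3 : ContDiff ℝ ∞ fun q : ℝ × ℝ × ℝ × ℝ ↦ q.2.2.1 := contDiff_fst.comp (contDiff_snd.comp contDiff_snd)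
    have h4 : ContDiff ℝ ∞ fun q : ℝ × ℝ × ℝ × ℝ ↦ q.2.2.2 := contDiff_snd.comp (contDiff_snd.comp contDiff_snd)
    exact (h1.prodMk h2).prodMk (h3.prodMk h4)
  contMDiff_invFun := by
    refine contMDiff_iff_contDiff.2 ?_
    have h1 : ContDiff ℝ ∞ fun p : (ℝ × ℝ) × (ℝ × ℝ) ↦ p.1.1 := contDiff_fst.comp contDiff_fst
    have h2 : ContDiff ℝ ∞ fun p : (ℝ × ℝ) × (ℝ × ℝ) ↦ p.1.2 := contDiff_snd.comp contDiff_fst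
    have h3 : ContDiff ℝ ∞ fun p : (ℝ × ℝ) × (ℝ × ℝ) ↦ p.2.1 := contDiff_fst.comp contDiff_snd
    have h4 : ContDiff ℝ ∞ fun p : (ℝ × ℝ) × (ℝ × ℝ) ↦ p.2.2 := contDiff_snd.comp contDiff_snd
    exact h1.prodMk (h2.prodMk (h3.prodMk h4))

/-- The value of `boxIn2`. [folklore] -/
@[simp] theorem boxIn2_apply (q : ℝ × ℝ × ℝ × ℝ) : boxIn2 q = ((q.1, q.2.1), (q.2.2.1, q.2.2.2)) := rfl

/-- The value of `boxIn2.symm`. [folklore] -/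
@[simp] theorem boxIn2_symm_apply (p : (ℝ × ℝ) × (ℝ × ℝ)) : boxIn2.symm p = (p.1.1, p.1.2, p.2.1, p.2.2) := rfl

variable {C}

/-- **The gauge shear is a local diffeomorphism** (the graph of `ℓ ↦ ℓ - C`, derivative `1`). [folklore] -/
theorem isLocalDiffeomorphAt_boxGaugeShear (hC : ContDiff ℝ ∞ fun p : ℝ × ℝ × ℝ ↦ C p.1 p.2.1 p.2.2)
    (q : ℝ × ℝ × ℝ × ℝ) :
    IsLocalDiffeomorphAt 𝓘(ℝ, ℝ × ℝ × ℝ × ℝ) 𝓘(ℝ, ℝ × ℝ × ℝ × ℝ) ∞ (boxGaugeShear C) q := by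
  -- `boxGaugeShear = boxIn⁻¹ ∘ graph ∘ boxIn`
  have h1 : IsLocalDiffeomorphAt 𝓘(ℝ, ℝ × ℝ × ℝ × ℝ) 𝓘(ℝ, (ℝ × ℝ × ℝ) × ℝ) ∞ boxIn q := boxIn.isLocalDiffeomorph q
  have h2 : IsLocalDiffeomorphAt 𝓘(ℝ, (ℝ × ℝ × ℝ) × ℝ) 𝓘(ℝ, (ℝ × ℝ × ℝ) × ℝ) ∞
      (fun p : (ℝ × ℝ × ℝ) × ℝ ↦ (p.1, p.2 - C p.1.1 p.1.2.1 p.1.2.2)) (boxIn q) := by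
    have hf : ContDiff ℝ ∞ fun p : (ℝ × ℝ × ℝ) × ℝ ↦ p.2 - C p.1.1 p.1.2.1 p.1.2.2 :=
      contDiff_snd.sub (ContDiff.comp (g := fun p : ℝ × ℝ × ℝ ↦ C p.1 p.2.1 p.2.2) (f := Prod.fst) hC contDiff_fst)
    refine isLocalDiffeomorphAt_graph_real isOpen_univ (mem_univ _) hf.contDiffOn (by exact_mod_cast le_top)
      one_ne_zero ?_
    simpa using (hasDerivAt_id (boxIn q).2).sub_const (C (boxIn q).1.1 (boxIn q).1.2.1 (boxIn q).1.2.2)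
  have h3 : IsLocalDiffeomorphAt 𝓘(ℝ, (ℝ × ℝ × ℝ) × ℝ) 𝓘(ℝ, ℝ × ℝ × ℝ × ℝ) ∞ boxIn.symm
      ((boxIn q).1, (boxIn q).2 - C (boxIn q).1.1 (boxIn q).1.2.1 (boxIn q).1.2.2) :=
    boxIn.symm.isLocalDiffeomorph _
  have h := (h1.comp (K := 𝓘(ℝ, (ℝ × ℝ × ℝ) × ℝ)) (P := (ℝ × ℝ × ℝ) × ℝ) h2).comp
    (K := 𝓘(ℝ, ℝ × ℝ × ℝ × ℝ)) (P := ℝ × ℝ × ℝ × ℝ) h3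
  exact isLocalDiffeomorphAt_congr_nhds' h (Eventually.of_forall fun q' ↦ rfl)

/-- **The box shell map is a local diffeomorphism** at every point of depth `e < 1`. [folklore] -/
theorem isLocalDiffeomorphAt_boxShellMap (hC : ContDiff ℝ ∞ fun p : ℝ × ℝ × ℝ ↦ C p.1 p.2.1 p.2.2)
    {q : ℝ × ℝ × ℝ × ℝ} (he : q.2.2.2 < 1) :
    IsLocalDiffeomorphAt 𝓘(ℝ, ℝ × ℝ × ℝ × ℝ) 𝓘(ℝ, ℝ × ℝ × ℝ × ℝ) ∞ (boxShellMap C) q := by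
  -- `boxShellMap = boxIn2⁻¹ ∘ faceGraph ∘ boxIn2 ∘ boxGaugeShear`
  have h0 := isLocalDiffeomorphAt_boxGaugeShear hC q
  have h1 : IsLocalDiffeomorphAt 𝓘(ℝ, ℝ × ℝ × ℝ × ℝ) 𝓘(ℝ, (ℝ × ℝ) × (ℝ × ℝ)) ∞ boxIn2 (boxGaugeShear C q) :=
    boxIn2.isLocalDiffeomorph _
  have h2 : IsLocalDiffeomorphAt 𝓘(ℝ, (ℝ × ℝ) × (ℝ × ℝ)) 𝓘(ℝ, (ℝ × ℝ) × (ℝ × ℝ)) ∞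
      (fun p : (ℝ × ℝ) × (ℝ × ℝ) ↦ (p.1, (faceT p.2.1 p.2.2, faceY p.2.1 p.2.2))) (boxIn2 (boxGaugeShear C q)) :=
    isLocalDiffeomorphAt_faceGraph (by simpa [boxGaugeShear] using he)
  have h3 : IsLocalDiffeomorphAt 𝓘(ℝ, (ℝ × ℝ) × (ℝ × ℝ)) 𝓘(ℝ, ℝ × ℝ × ℝ × ℝ) ∞ boxIn2.symm
      ((boxIn2 (boxGaugeShear C q)).1, (faceT (boxIn2 (boxGaugeShear C q)).2.1 (boxIn2 (boxGaugeShear C q)).2.2,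
        faceY (boxIn2 (boxGaugeShear C q)).2.1 (boxIn2 (boxGaugeShear C q)).2.2)) :=
    boxIn2.symm.isLocalDiffeomorph _
  have h := ((h0.comp (K := 𝓘(ℝ, (ℝ × ℝ) × (ℝ × ℝ))) (P := (ℝ × ℝ) × (ℝ × ℝ)) h1).comp
    (K := 𝓘(ℝ, (ℝ × ℝ) × (ℝ × ℝ))) (P := (ℝ × ℝ) × (ℝ × ℝ)) h2).comp
    (K := 𝓘(ℝ, ℝ × ℝ × ℝ × ℝ)) (P := ℝ × ℝ × ℝ × ℝ) h3
  exact isLocalDiffeomorphAt_congr_nhds' h (Eventually.of_forall fun q' ↦ rfl)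

/-- **The box shell map is smooth** for a smooth gauge. [folklore] -/
theorem contDiff_boxShellMap (hC : ContDiff ℝ ∞ fun p : ℝ × ℝ × ℝ ↦ C p.1 p.2.1 p.2.2) :
    ContDiff ℝ ∞ (boxShellMap C) := by
  have h1 : ContDiff ℝ ∞ fun q : ℝ × ℝ × ℝ × ℝ ↦ q.1 := contDiff_fst
  have h2 : ContDiff ℝ ∞ fun q : ℝ × ℝ × ℝ × ℝ ↦ q.2.1 := contDiff_fst.comp contDiff_snd
  have h34 : ContDiff ℝ ∞ fun q : ℝ × ℝ × ℝ × ℝ ↦ q.2.2 := contDiff_snd.comp contDiff_snd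
  have hC' : ContDiff ℝ ∞ fun q : ℝ × ℝ × ℝ × ℝ ↦ C q.1 q.2.2.1 q.2.2.2 :=
    ContDiff.comp (g := fun p : ℝ × ℝ × ℝ ↦ C p.1 p.2.1 p.2.2) (f := fun q : ℝ × ℝ × ℝ × ℝ ↦ (q.1, q.2.2)) hC
      (h1.prodMk h34)
  have hF : ContDiff ℝ ∞ fun q : ℝ × ℝ × ℝ × ℝ ↦ (faceT q.2.2.1 q.2.2.2, faceY q.2.2.1 q.2.2.2) :=
    contDiff_faceTY.comp h34
  exact h1.prodMk ((h2.sub hC').prodMk ((contDiff_fst.comp hF).prodMk (contDiff_snd.comp hF)))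

/-- **Injectivity of the box shell map** for depths `< 1`: equal values have equal `n`, equal
depth, equal direction `(cos θ, sin θ)`, and then equal `ℓ` as soon as the gauge only depends on
the direction. [folklore] -/
theorem boxShellMap_inj (hCd : ∀ n θ θ' e, Real.cos θ = Real.cos θ' → Real.sin θ = Real.sin θ' → C n θ e = C n θ' e)
    {q q' : ℝ × ℝ × ℝ × ℝ} (he : q.2.2.2 < 1) (he' : q'.2.2.2 < 1) (h : boxShellMap C q = boxShellMap C q') :
    q.1 = q'.1 ∧ q.2.1 = q'.2.1 ∧ q.2.2.2 = q'.2.2.2 ∧ Real.cos q.2.2.1 = Real.cos q'.2.2.1 ∧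
      Real.sin q.2.2.1 = Real.sin q'.2.2.1 := by
  simp only [boxShellMap, Prod.mk.injEq] at h
  obtain ⟨hn, hℓ, hT, hY⟩ := h
  obtain ⟨hee, hc, hs⟩ := face_inj he he' hT hY
  refine ⟨hn, ?_, hee, hc, hs⟩
  rw [hn, hee, hCd q'.1 q.2.2.1 q'.2.2.1 q'.2.2.2 hc hs] at hℓ
  linarith

end Face

/-! ### The corner at the hole -/

section Corner

variable (c p₁ ρb : ℝ)

/-- **Gompf's bend as a diffeomorphism of the plane** (`fishBend`/`fishBendInv`). [cite: GompfAGT2010, Lemma 2.2 (proof: the collar I × ∂Φ around the corner of N ∪ h)] -/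
def fishBendDiffeo (hc : c ≠ 0) : (ℝ × ℝ) ≃ₘ⟮𝓘(ℝ, ℝ × ℝ), 𝓘(ℝ, ℝ × ℝ)⟯ (ℝ × ℝ) where
  toFun := fishBend c p₁ ρb
  invFun := fishBendInv c p₁ ρb
  left_inv := fishBendInv_fishBend hc
  right_inv := fishBend_fishBendInv hc
  contMDiff_toFun := contMDiff_iff_contDiff.2 (contDiff_fishBend c p₁ ρb)
  contMDiff_invFun := contMDiff_iff_contDiff.2 (contDiff_fishBendInv c p₁ ρb)

/-- The value of `fishBendDiffeo`. [folklore] -/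
@[simp] theorem fishBendDiffeo_apply (hc : c ≠ 0) (x : ℝ × ℝ) : fishBendDiffeo c p₁ ρb hc x = fishBend c p₁ ρb x := rfl

variable (S : ℝ → ℝ → ℝ)

/-- **The corner map** in polar source coordinates `(ϱ, φ, ℓ, e)` (`v = ϱ e^{iφ}` the hole
offset, `ℓ` the fibre angle, `e` the depth):
`(W e^{iφ}, 1 + E h, ℓ + φ - Ŝ(ϱ, φ))`, `(W, E) = fishBend (ϱ, e)` — the offset of the box point
`(n, y)` from the hole, its base coordinate, and its fibre angle. [cite: GompfAGT2010, Lemma 2.2 (Φ = N ∪_γ 2-handle, the corner rounded)] -/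
def cornerMap (q : ℝ × ℝ × ℝ × ℝ) : ℂ × ℝ × ℝ :=
  (((fishBend c p₁ ρb (q.1, q.2.2.2)).1 : ℂ) * exp (q.2.1 * I),
    1 + (fishBend c p₁ ρb (q.1, q.2.2.2)).2 * bxH, q.2.2.1 + q.2.1 - S q.1 q.2.1)

/-- The first stage: the shear and the bend, `(ϱ, φ, ℓ, e) ↦ ((1 + E h, ℓ + φ - Ŝ), (W, φ))`. [folklore] -/
def cornerStage (q : ℝ × ℝ × ℝ × ℝ) : (ℝ × ℝ) × (ℝ × ℝ) :=
  ((1 + (fishBend c p₁ ρb (q.1, q.2.2.2)).2 * bxH, q.2.2.1 + q.2.1 - S q.1 q.2.1),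
    ((fishBend c p₁ ρb (q.1, q.2.2.2)).1, q.2.1))

/-- **The corner map factors** (statement) — see `cornerMap_eq` below. The bend-and-shear core in
graph-friendly coordinates: `((φ, ℓ), (ϱ, e)) ↦ ((φ, ℓ + φ - Ŝ(ϱ, φ)), fishBend (ϱ, e))`. [folklore] -/
def cornerCore (p : (ℝ × ℝ) × (ℝ × ℝ)) : (ℝ × ℝ) × (ℝ × ℝ) :=
  ((p.1.1, p.1.2 + p.1.1 - S p.2.1 p.1.1), fishBend c p₁ ρb p.2)

variable {c p₁ ρb S}

/-- **The corner map factors** as `twistOut ∘ polar graph ∘ cornerStage` up to the order of the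
last two coordinates: `cornerMap q = (W e^{iφ}, T, L)` while
`twistOut ((T, L'), polarC (W, φ - L')) = …`; we use the direct planar factoring instead:
`cornerMap = (polar on (W, φ)) × id ∘ cornerStage`. [folklore] -/
theorem cornerMap_eq (q : ℝ × ℝ × ℝ × ℝ) :
    cornerMap c p₁ ρb S q = (polarC (cornerStage c p₁ ρb S q).2, (cornerStage c p₁ ρb S q).1) := rfl

/-- Smoothness of the corner stage for smooth `Ŝ`. [folklore] -/
theorem contDiff_cornerStage (hS : ContDiff ℝ ∞ fun p : ℝ × ℝ ↦ S p.1 p.2) :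
    ContDiff ℝ ∞ (cornerStage c p₁ ρb S) := by
  have h1 : ContDiff ℝ ∞ fun q : ℝ × ℝ × ℝ × ℝ ↦ q.1 := contDiff_fst
  have h2 : ContDiff ℝ ∞ fun q : ℝ × ℝ × ℝ × ℝ ↦ q.2.1 := contDiff_fst.comp contDiff_snd
  have h3 : ContDiff ℝ ∞ fun q : ℝ × ℝ × ℝ × ℝ ↦ q.2.2.1 := contDiff_fst.comp (contDiff_snd.comp contDiff_snd)
  have h4 : ContDiff ℝ ∞ fun q : ℝ × ℝ × ℝ × ℝ ↦ q.2.2.2 := contDiff_snd.comp (contDiff_snd.comp contDiff_snd)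
  have hB : ContDiff ℝ ∞ fun q : ℝ × ℝ × ℝ × ℝ ↦ fishBend c p₁ ρb (q.1, q.2.2.2) :=
    (contDiff_fishBend c p₁ ρb).comp (h1.prodMk h4)
  have hS' : ContDiff ℝ ∞ fun q : ℝ × ℝ × ℝ × ℝ ↦ S q.1 q.2.1 :=
    ContDiff.comp (g := fun p : ℝ × ℝ ↦ S p.1 p.2) (f := fun q : ℝ × ℝ × ℝ × ℝ ↦ (q.1, q.2.1)) hS (h1.prodMk h2)
  exact ((contDiff_const.add ((contDiff_snd.comp hB).mul contDiff_const)).prodMk ((h3.add h2).sub hS')).prodMk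
    ((contDiff_fst.comp hB).prodMk h2)

/-- Smoothness of the corner map for smooth `Ŝ`. [folklore] -/
theorem contDiff_cornerMap (hS : ContDiff ℝ ∞ fun p : ℝ × ℝ ↦ S p.1 p.2) : ContDiff ℝ ∞ (cornerMap c p₁ ρb S) := by
  have h := contDiff_cornerStage (c := c) (p₁ := p₁) (ρb := ρb) hS
  have heq : cornerMap c p₁ ρb S = fun q ↦ (polarC (cornerStage c p₁ ρb S q).2, (cornerStage c p₁ ρb S q).1) :=
    funext cornerMap_eq
  rw [heq]
  exact (contDiff_polarC.comp (contDiff_snd.comp h)).prodMk (contDiff_fst.comp h)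

/-- The output reordering `((φ, L), (W, E)) ↦ ((1 + E h, L), (W, φ))`, a diffeomorphism. [folklore] -/
def cornerOut : ((ℝ × ℝ) × (ℝ × ℝ)) ≃ₘ⟮𝓘(ℝ, (ℝ × ℝ) × (ℝ × ℝ)), 𝓘(ℝ, (ℝ × ℝ) × (ℝ × ℝ))⟯ ((ℝ × ℝ) × (ℝ × ℝ)) where
  toFun p := ((1 + p.2.2 * bxH, p.1.2), (p.2.1, p.1.1))
  invFun r := ((r.2.2, r.1.2), (r.2.1, (r.1.1 - 1) / bxH))
  left_inv p := by
    obtain ⟨⟨φ, L⟩, W, E⟩ := p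
    simp [bxH_pos.ne']
  right_inv r := by
    obtain ⟨⟨T, L⟩, W, φ⟩ := r
    simp [bxH_pos.ne']
  contMDiff_toFun := by
    refine contMDiff_iff_contDiff.2 ?_
    have h1 : ContDiff ℝ ∞ fun p : (ℝ × ℝ) × (ℝ × ℝ) ↦ p.1.1 := contDiff_fst.comp contDiff_fst
    have h2 : ContDiff ℝ ∞ fun p : (ℝ × ℝ) × (ℝ × ℝ) ↦ p.1.2 := contDiff_snd.comp contDiff_fst
    have h3 : ContDiff ℝ ∞ fun p : (ℝ × ℝ) × (ℝ × ℝ) ↦ p.2.1 := contDiff_fst.comp contDiff_snd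
    have h4 : ContDiff ℝ ∞ fun p : (ℝ × ℝ) × (ℝ × ℝ) ↦ p.2.2 := contDiff_snd.comp contDiff_snd
    exact ((contDiff_const.add (h4.mul contDiff_const)).prodMk h2).prodMk (h3.prodMk h1)
  contMDiff_invFun := by
    refine contMDiff_iff_contDiff.2 ?_
    have h1 : ContDiff ℝ ∞ fun p : (ℝ × ℝ) × (ℝ × ℝ) ↦ p.1.1 := contDiff_fst.comp contDiff_fst
    have h2 : ContDiff ℝ ∞ fun p : (ℝ × ℝ) × (ℝ × ℝ) ↦ p.1.2 := contDiff_snd.comp contDiff_fst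
    have h3 : ContDiff ℝ ∞ fun p : (ℝ × ℝ) × (ℝ × ℝ) ↦ p.2.1 := contDiff_fst.comp contDiff_snd
    have h4 : ContDiff ℝ ∞ fun p : (ℝ × ℝ) × (ℝ × ℝ) ↦ p.2.2 := contDiff_snd.comp contDiff_snd
    exact (h4.prodMk h2).prodMk (h3.prodMk ((h1.sub contDiff_const).div_const _))

/-- **The corner stage factors** as `cornerOut ∘ cornerCore ∘ shellIn` (`shellIn (ϱ, φ, ℓ, e) = ((φ, e)…)` —
we use the reordering `(ϱ, φ, ℓ, e) ↦ ((φ, ℓ), (ϱ, e))`). [folklore] -/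
theorem cornerStage_eq (q : ℝ × ℝ × ℝ × ℝ) :
    cornerStage c p₁ ρb S q = cornerOut (cornerCore c p₁ ρb S ((q.2.1, q.2.2.1), (q.1, q.2.2.2))) := by
  simp only [cornerStage, cornerOut, cornerCore]
  rfl

/-- The reordering `(ϱ, φ, ℓ, e) ↦ ((φ, ℓ), (ϱ, e))`, a diffeomorphism. [folklore] -/
def cornerIn : (ℝ × ℝ × ℝ × ℝ) ≃ₘ⟮𝓘(ℝ, ℝ × ℝ × ℝ × ℝ), 𝓘(ℝ, (ℝ × ℝ) × (ℝ × ℝ))⟯ ((ℝ × ℝ) × (ℝ × ℝ)) where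
  toFun q := ((q.2.1, q.2.2.1), (q.1, q.2.2.2))
  invFun p := (p.2.1, p.1.1, p.1.2, p.2.2)
  left_inv q := by simp
  right_inv p := by simp
  contMDiff_toFun := by
    refine contMDiff_iff_contDiff.2 ?_
    have h1 : ContDiff ℝ ∞ fun q : ℝ × ℝ × ℝ × ℝ ↦ q.1 := contDiff_fst
    have h2 : ContDiff ℝ ∞ fun q : ℝ × ℝ × ℝ × ℝ ↦ q.2.1 := contDiff_fst.comp contDiff_snd
    have h3 : ContDiff ℝ ∞ fun q : ℝ × ℝ × ℝ × ℝ ↦ q.2.2.1 := contDiff_fst.comp (contDiff_snd.comp contDiff_snd)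
    have h4 : ContDiff ℝ ∞ fun q : ℝ × ℝ × ℝ × ℝ ↦ q.2.2.2 := contDiff_snd.comp (contDiff_snd.comp contDiff_snd)
    exact (h2.prodMk h3).prodMk (h1.prodMk h4)
  contMDiff_invFun := by
    refine contMDiff_iff_contDiff.2 ?_
    have h1 : ContDiff ℝ ∞ fun p : (ℝ × ℝ) × (ℝ × ℝ) ↦ p.1.1 := contDiff_fst.comp contDiff_fst
    have h2 : ContDiff ℝ ∞ fun p : (ℝ × ℝ) × (ℝ × ℝ) ↦ p.1.2 := contDiff_snd.comp contDiff_fst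
    have h3 : ContDiff ℝ ∞ fun p : (ℝ × ℝ) × (ℝ × ℝ) ↦ p.2.1 := contDiff_fst.comp contDiff_snd
    have h4 : ContDiff ℝ ∞ fun p : (ℝ × ℝ) × (ℝ × ℝ) ↦ p.2.2 := contDiff_snd.comp contDiff_snd
    exact h3.prodMk (h1.prodMk (h2.prodMk h4))

/-- The value of `cornerIn`. [folklore] -/
@[simp] theorem cornerIn_apply (q : ℝ × ℝ × ℝ × ℝ) : cornerIn q = ((q.2.1, q.2.2.1), (q.1, q.2.2.2)) := rfl

/-- **The corner core is a local diffeomorphism** (a shear in `ℓ` over the graph of the bend). [folklore] -/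
theorem isLocalDiffeomorphAt_cornerCore (hc : c ≠ 0) (hS : ContDiff ℝ ∞ fun p : ℝ × ℝ ↦ S p.1 p.2)
    (p : (ℝ × ℝ) × (ℝ × ℝ)) :
    IsLocalDiffeomorphAt 𝓘(ℝ, (ℝ × ℝ) × (ℝ × ℝ)) 𝓘(ℝ, (ℝ × ℝ) × (ℝ × ℝ)) ∞ (cornerCore c p₁ ρb S) p := by
  -- `cornerCore = (bend on the second factor) then (shear of ℓ)`: both graph-type local diffeos
  have hB : IsLocalDiffeomorphAt 𝓘(ℝ, (ℝ × ℝ) × (ℝ × ℝ)) 𝓘(ℝ, (ℝ × ℝ) × (ℝ × ℝ)) ∞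
      (Prod.map id (fishBend c p₁ ρb)) p := by
    have h := IsLocalDiffeomorphAt.prodMap' ((Diffeomorph.refl 𝓘(ℝ, ℝ × ℝ) (ℝ × ℝ) ∞).isLocalDiffeomorph p.1)
      ((fishBendDiffeo c p₁ ρb hc).isLocalDiffeomorph p.2)
    rw [← modelWithCornersSelf_prod, chartedSpaceSelf_prod] at h
    exact h
  -- the shear `((φ, ℓ), x) ↦ ((φ, ℓ + φ - Ŝ(x.1?, φ)), x)`: careful, `Ŝ` is evaluated at the
  -- ORIGINAL `ϱ = p.2.1`, not at `W`; so shear first, bend second.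
  have hSh : IsLocalDiffeomorphAt 𝓘(ℝ, (ℝ × ℝ) × (ℝ × ℝ)) 𝓘(ℝ, (ℝ × ℝ) × (ℝ × ℝ)) ∞
      (fun r : (ℝ × ℝ) × (ℝ × ℝ) ↦ ((r.1.1, r.1.2 + r.1.1 - S r.2.1 r.1.1), r.2)) p := by
    -- as a graph over the carried `((φ), (ϱ, e))` with unknown `ℓ`: reorder to `((φ, (ϱ, e)), ℓ)`
    let K : ((ℝ × ℝ) × (ℝ × ℝ)) ≃L[ℝ] ((ℝ × (ℝ × ℝ)) × ℝ) :=
      { toFun := fun r ↦ ((r.1.1, r.2), r.1.2)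
        invFun := fun s ↦ ((s.1.1, s.2), s.1.2)
        map_add' := fun _ _ ↦ rfl
        map_smul' := fun _ _ ↦ rfl
        left_inv := fun _ ↦ rfl
        right_inv := fun _ ↦ rfl
        continuous_toFun := by fun_prop
        continuous_invFun := by fun_prop }
    have hK := K.toDiffeomorph.isLocalDiffeomorph p
    have hG : IsLocalDiffeomorphAt 𝓘(ℝ, (ℝ × (ℝ × ℝ)) × ℝ) 𝓘(ℝ, (ℝ × (ℝ × ℝ)) × ℝ) ∞
        (fun s : (ℝ × (ℝ × ℝ)) × ℝ ↦ (s.1, s.2 + s.1.1 - S s.1.2.1 s.1.1)) (K p) := by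
      have hf : ContDiff ℝ ∞ fun s : (ℝ × (ℝ × ℝ)) × ℝ ↦ s.2 + s.1.1 - S s.1.2.1 s.1.1 :=
        (contDiff_snd.add (contDiff_fst.comp contDiff_fst)).sub
          (ContDiff.comp (g := fun p : ℝ × ℝ ↦ S p.1 p.2)
            (f := fun s : (ℝ × (ℝ × ℝ)) × ℝ ↦ (s.1.2.1, s.1.1)) hS
            ((contDiff_fst.comp (contDiff_snd.comp contDiff_fst)).prodMk (contDiff_fst.comp contDiff_fst)))
      refine isLocalDiffeomorphAt_graph_real isOpen_univ (mem_univ _) hf.contDiffOn (by exact_mod_cast le_top)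
        one_ne_zero ?_
      simpa using ((hasDerivAt_id (K p).2).add_const (K p).1.1).sub_const (S (K p).1.2.1 (K p).1.1)
    have hK' := K.symm.toDiffeomorph.isLocalDiffeomorph (((K p).1, (K p).2 + (K p).1.1 - S (K p).1.2.1 (K p).1.1))
    have h := (hK.comp (K := 𝓘(ℝ, (ℝ × (ℝ × ℝ)) × ℝ)) (P := (ℝ × (ℝ × ℝ)) × ℝ) hG).comp
      (K := 𝓘(ℝ, (ℝ × ℝ) × (ℝ × ℝ))) (P := (ℝ × ℝ) × (ℝ × ℝ)) hK'
    exact isLocalDiffeomorphAt_congr_nhds' h (Eventually.of_forall fun r ↦ rfl)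
  have hB' : IsLocalDiffeomorphAt 𝓘(ℝ, (ℝ × ℝ) × (ℝ × ℝ)) 𝓘(ℝ, (ℝ × ℝ) × (ℝ × ℝ)) ∞
      (Prod.map id (fishBend c p₁ ρb)) ((p.1.1, p.1.2 + p.1.1 - S p.2.1 p.1.1), p.2) := by
    have h := IsLocalDiffeomorphAt.prodMap'
      ((Diffeomorph.refl 𝓘(ℝ, ℝ × ℝ) (ℝ × ℝ) ∞).isLocalDiffeomorph (p.1.1, p.1.2 + p.1.1 - S p.2.1 p.1.1))
      ((fishBendDiffeo c p₁ ρb hc).isLocalDiffeomorph p.2)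
    rw [← modelWithCornersSelf_prod, chartedSpaceSelf_prod] at h
    exact h
  have h := hSh.comp (K := 𝓘(ℝ, (ℝ × ℝ) × (ℝ × ℝ))) (P := (ℝ × ℝ) × (ℝ × ℝ)) hB'
  exact isLocalDiffeomorphAt_congr_nhds' h (Eventually.of_forall fun r ↦ rfl)

/-- **The corner map is a local diffeomorphism** where `W = (fishBend (ϱ, e)).1 ≠ 0` (for `c ≠ 0`
and smooth `Ŝ`). [folklore] -/
theorem isLocalDiffeomorphAt_cornerMap (hc : c ≠ 0) (hS : ContDiff ℝ ∞ fun p : ℝ × ℝ ↦ S p.1 p.2)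
    {q : ℝ × ℝ × ℝ × ℝ} (hW : (fishBend c p₁ ρb (q.1, q.2.2.2)).1 ≠ 0) :
    IsLocalDiffeomorphAt 𝓘(ℝ, ℝ × ℝ × ℝ × ℝ) 𝓘(ℝ, ℂ × ℝ × ℝ) ∞ (cornerMap c p₁ ρb S) q := by
  -- `cornerMap = (swap ∘ polar graph) ∘ cornerOut ∘ cornerCore ∘ cornerIn`
  have h1 : IsLocalDiffeomorphAt 𝓘(ℝ, ℝ × ℝ × ℝ × ℝ) 𝓘(ℝ, (ℝ × ℝ) × (ℝ × ℝ)) ∞ cornerIn q :=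
    cornerIn.isLocalDiffeomorph q
  have h2 := isLocalDiffeomorphAt_cornerCore (p₁ := p₁) (ρb := ρb) hc hS (cornerIn q)
  have h3 := cornerOut.isLocalDiffeomorph (cornerCore c p₁ ρb S (cornerIn q))
  have hstage : cornerStage c p₁ ρb S = cornerOut ∘ cornerCore c p₁ ρb S ∘ cornerIn :=
    funext fun q' ↦ cornerStage_eq q'
  have h123 : IsLocalDiffeomorphAt 𝓘(ℝ, ℝ × ℝ × ℝ × ℝ) 𝓘(ℝ, (ℝ × ℝ) × (ℝ × ℝ)) ∞ (cornerStage c p₁ ρb S) q := by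
    rw [hstage]
    exact (h1.comp (K := 𝓘(ℝ, (ℝ × ℝ) × (ℝ × ℝ))) (P := (ℝ × ℝ) × (ℝ × ℝ)) h2).comp
      (K := 𝓘(ℝ, (ℝ × ℝ) × (ℝ × ℝ))) (P := (ℝ × ℝ) × (ℝ × ℝ)) h3
  -- the polar graph on the second factor and the swap
  have h4 : IsLocalDiffeomorphAt 𝓘(ℝ, (ℝ × ℝ) × (ℝ × ℝ)) 𝓘(ℝ, (ℝ × ℝ) × ℂ) ∞
      (fun r : (ℝ × ℝ) × (ℝ × ℝ) ↦ (r.1, polarC r.2)) (cornerStage c p₁ ρb S q) :=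
    isLocalDiffeomorphAt_polarGraph (by simpa [cornerStage] using hW)
  have h5 := (ContinuousLinearEquiv.prodComm ℝ (ℝ × ℝ) ℂ).toDiffeomorph.isLocalDiffeomorph
    ((cornerStage c p₁ ρb S q).1, polarC (cornerStage c p₁ ρb S q).2)
  have h := (h123.comp (K := 𝓘(ℝ, (ℝ × ℝ) × ℂ)) (P := (ℝ × ℝ) × ℂ) h4).comp
    (K := 𝓘(ℝ, ℂ × (ℝ × ℝ))) (P := ℂ × (ℝ × ℝ)) h5
  exact isLocalDiffeomorphAt_congr_nhds' h (Eventually.of_forall fun q' ↦ cornerMap_eq q')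

end Corner

end Literature.Topology.FourManifolds
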